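import Literature.NumberTheory.EllipticCurves.HeegnerPointsKolyvaginExceptionalPrimaryProofs
import Literature.NumberTheory.EllipticCurves.HeegnerPointsKolyvaginPrimaryPointsProofs
import Literature.NumberTheory.EllipticCurves.HeegnerPointsKolyvaginPrimaryProp82Proofs
import Literature.NumberTheory.EllipticCurves.SerreOpenImageFinalProofs
import Literature.NumberTheory.EllipticCurves.WeilPairingProofs
import Literature.NumberTheory.Automorphic.ChebotarevArtinRepHolds
import HarnessLib

/-!
# Kolyvagin's Theorem A in the excluded cases from Heegner-type points and Kolyvagin
# reciprocity at `λ`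

Sibling *proofs* file (theorems only: no definition, no named fact, no instance) for the named
fact `Literature.NumberTheory.EllipticCurves.Kolyvagin1990_thmA_of_hasCM_or_discr N W K`
(`HeegnerPointsKolyvaginProofs`): Kolyvagin's Theorem A — *"Suppose `y_K` has infinite order.
Then `E(K)` has rank `1` and `Ш(E/K)` is finite"* (W. G. McCallum, *Kolyvagin's work on
Shafarevich–Tate groups*, LMS Lecture Note Ser. **153** (1991), §1, Theorem (Kolyvagin), stated
there for `R = End(E)` arbitrary and every `K = ℚ(√-D)` with the Heegner hypothesis; B. H. Gross,
*Kolyvagin's work on modular elliptic curves*, same volume, Thm. 1.3 = [K1, Thm. A]) — in the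
cases the tree's main line sets aside: `E` with complex multiplication, or `d_K ∈ {-3, -4}`
(Gross §1: *"For simplicity, we assume that `D ≠ 3, 4`"*; Gross §2 and McCallum §3: *"we assume
that `E` does not have complex multiplication"*).

## What this file adds

`HeegnerPointsKolyvaginExceptionalPrimaryProofs` reduced the leaf to Kolyvagin's descent data
modulo `p^M` at almost all primes (`Kolyvagin1990_thmA_of_hasCM_or_discr_of_leavesM_of_not_hasCM`
for `E` without CM, `Kolyvagin1990_thmA_of_hasCM_or_discr_of_localDataM` in general), the data
being fed by two *class-level* Euler-system leaves: **(A)** Kolyvagin's classes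
`c_M(n) ∈ H¹(K, E_{p^M})` with McCallum's (6), Lemma 4.3, Prop. 4.4 and Gross's Prop. 5.4 (2),
and **(B)** McCallum's Lemma 5.3 with Prop. 2.2 (local Tate duality at `λ` + reciprocity),
together with three named facts of the tree (Serre's open image theorem, the Čebotarev density
theorem, the Weil pairing). Since then the tree has moved below all five inputs, uniformly in
`End(E)` and `d_K`:

* McCallum's cocycle (`kolyvaginClass`, `HeegnerPointsKolyvaginPrimaryClassesProofs`: Gross §4
  (4.6), McCallum Lemma 4.1) turns leaf (A) into a **point-level** leaf (A'): points
  `P_n ∈ A_n ⊆ E(K̄)` with McCallum's (4) and Gross's Prop. 5.4 (1), `P_1 = y_K`, plus the local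
  statements about their classes (`KolyvaginDescent.exists_leafA_of_points`,
  `HeegnerPointsKolyvaginPrimaryPointsProofs`) — for *any* elliptic `E/ℚ` and imaginary
  quadratic `K`;
* McCallum's Lemma 5.3 is proved from the one remaining hypothesis **(R)_M** — Kolyvagin
  reciprocity at `λ`: for an alternating left-non-degenerate pairing `e` on `E_{p^M}`,
  `e([s, F], [c', σ]) = 0` for Selmer `s`, classes `c'` Selmer off `λ`, Frobenii `F` and inertia
  elements `σ` at `𝔔 ∣ λ` (McCallum Prop. 2.2 through Kolyvagin's formula (7.6)) —
  `hdual_of_kolyvaginReciprocityM` (`HeegnerPointsKolyvaginPrimaryProp82Proofs`), again with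
  **no** hypothesis on `End(E)` or `d_K`;
* the three named facts are now theorems: `serre_open_image_holds`
  (`SerreOpenImageFinalProofs`), `Automorphic.chebotarev_artinRep_holds`
  (`ChebotarevArtinRepHolds`), `WeierstrassCurve.exists_weilPairing_holds` (`WeilPairingProofs`).

Hence, exactly parallel to the `p`-primary leaf's
`KolyvaginDescent.Kolyvagin1990_sha_primary_finite_of_pointsM_of_thmA`:

* `Kolyvagin1990_thmA_of_hasCM_or_discr_of_pointsM_of_not_hasCM` — **`E` without CM,
  `K ∈ {ℚ(√-3), ℚ(i)}`:** the leaf follows from (A') at the primes `p ∤ 2d_K` with `ρ̄_{E,p}`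
  onto (over these two fields the ring class groups `G_ℓ = Gal(K_ℓ/K_1) ≅ F_λ^×/F_ℓ^×𝒪_K^×`
  of Gross §3 have order `(ℓ+1)/u_K`, `u_K = #𝒪_K^×/2 ∈ {3, 2}`, and the Hecke divisor
  `T_ℓ x_1` is `u_K` times the trace of `x_ℓ`, so that Kolyvagin's derivative (3.5) and the point
  `P_ℓ = D_ℓ y_ℓ` modulo `p^M` are available for `p ∤ u_K` — [K1]), (R)_M at the same primes, and
  Kolyvagin's
  [K1] at the finitely many residual primes (`p ∣ 2d_K` or `ρ̄_{E,p}` not onto — finite by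
  Serre) — **and nothing else** (no named-fact hypothesis remains);
* `Kolyvagin1990_thmA_of_hasCM_or_discr_of_pointsM_of_localDataM` — **CM-capable form:** the
  leaf from (A'), (R)_M (for all odd `p`), `E(K)[p] = 0` and McCallum's Cor. 3.2 at level `p^M`
  (**(C)**, for CM to be proved for the image `Aut_R(E_p)`, McCallum §1) off a finite residual
  set, and [K1] on it;
* `Kolyvagin1990_thmA_of_hasCM_or_discr_of_pointsM` — the two combined (`by_cases W.HasCM`);
* `kolyvagin_of_pointsM_of_not_hasCM` — going one step further, **Kolyvagin's theorem
  `kolyvagin N W K` itself, for `E` without CM over every imaginary quadratic `K`** (main case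
  and `ℚ(√-3), ℚ(i)` alike), from (A') at the primes `p ∤ 2u_K` with `ρ̄_{E,p}` onto, (R)_M, and
  [K1] at the residual primes — assembled directly by
  `WeierstrassCurve.mordellWeilRank_eq_one_and_shaFinite_of_hypothesesM` (Gross §2 at every
  level), so that for non-CM curves the level-`p` named facts `Gross1991_prop_2_1`,
  `Gross1991_kolyvaginClasses`, `Gross1991_prop_8_2` and both leaves
  `Kolyvagin1990_sha_primary_finite`, `Kolyvagin1990_thmA_of_hasCM_or_discr` of
  `kolyvagin_of_Gross1991` are bypassed (the two leaves being recovered from the conclusion by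
  `Kolyvagin1990_sha_primary_finite_of_kolyvagin`, `Kolyvagin1990_thmA_of_hasCM_or_discr_of_kolyvagin`);
* `kolyvagin_of_pointsM` — the same for every `E/ℚ` (CM curves through the CM-capable form).

What remains hypothetical is therefore the same frontier as the main case of the tree: the
Heegner points `y_n ∈ E(K_n)` over ring class fields with Gross's Prop. 3.7 and Prop. 5.3 and the
local behaviour of the classes of `P_n = D_n y_n` (Gross Prop. 6.2, McCallum Prop. 4.4: CM theory
on `X₀(N)`, Eichler–Shimura, Néron models — the content of (A')), the reciprocity law (R)_M, and
[K1] at the residual primes; for CM curves in addition Cor. 3.2 and `E(K_n)[p] = 0` for the image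
`Aut_R(E_p)`. (The alternative "twist route" of `HeegnerPointsKolyvaginExceptionalTwistProofs`
derives the non-CM half from Theorem A in the main case plus Gross–Zagier and Waldspurger-type
non-vanishing instead.) No new named fact is introduced; axioms are the standard three.

## References

* [McCallumLMS1991] W. G. McCallum, *Kolyvagin's work on Shafarevich–Tate groups*, in
  *`L`-functions and arithmetic (Durham, 1989)*, LMS Lecture Note Ser. 153, CUP (1991), 295–316:
  §1 Theorem (Kolyvagin); §2 Prop. 2.2; §3 Cor. 3.2; §4 (4)–(6), Lemma 4.1, Lemma 4.3, Prop. 4.4;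
  §5 Lemma 5.1, Lemma 5.3 (held `book:editornd-l-functions-arithmetic`, PDF pp. 276–286).
* [GrossLMS1991] B. H. Gross, *Kolyvagin's work on modular elliptic curves*, same volume,
  235–256: §1 Thm. 1.3, §2, §3 (3.3)–(3.5), Prop. 3.7, §4 (4.1)–(4.6), Lemma 4.3, Props. 5.3,
  5.4, 6.2 (held, PDF pp. 212–222).
* [Kolyvagin1990] V. A. Kolyvagin, *Euler systems*, in *The Grothendieck Festschrift II*, Progr.
  Math. 87 (1990), 435–483, Thm. A (cite only; not held — acq-00132 cite-only).
* [Serre1972] J.-P. Serre, Invent. Math. 15 (1972), §4.2 Théorème 2.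
-/

noncomputable section

open scoped Classical
open WeierstrassCurve NumberField IsDedekindDomain Field
open Literature.NumberTheory.GaloisRepresentations

universe u

namespace Literature.NumberTheory.EllipticCurves

open KolyvaginDescent

section Exceptional

variable (N : ℕ) [NeZero N] (W : WeierstrassCurve ℚ) (K : Type u) [Field K] [NumberField K]

/-- **The sub-case `E` without CM, `d_K ∈ {-3, -4}`, from Heegner-type points and Kolyvagin
reciprocity alone.** `Kolyvagin1990_thmA_of_hasCM_or_discr N W K` holds for a curve `E = W`
without complex multiplication (so that only `K = ℚ(√-3), ℚ(i)` remain of the leaf's hypothesis)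
as soon as, for `d_K ∈ {-3, -4}`, every prime `p ∤ 2d_K` with `ρ̄_{E,p}` onto, every `M ≥ 1` and
the complex conjugation `c ≠ 1` of `K`:
* `hpoints` = **leaf (A')**: a sign `ε = ±1` with Gross's Prop. 5.3 for `y_K` (`c y_K - ε y_K`
  torsion), a lift `τ` of `c` to `K̄`, and for every `m` a `Γ_K`- and `τ`-stable,
  `p^M`-torsion-free subgroup `A_m ⊆ E(K̄)` (printed `E(K_m)`, Gross Lemma 4.3) with a point
  `P_m ∈ A_m`, `[P_m] ∈ (A_m/p^M)^{Γ_K}` (McCallum (4)), `P_1 = y_K` (Gross (4.1)),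
  `τ P_m ≡ ε(-1)^{f_m} P_m (mod p^M A_m)` at the Kolyvagin levels (Gross Prop. 5.4 (1)), and the
  local behaviour of the Kolyvagin classes of the `P_m` (McCallum Lemma 4.3 = Gross Prop. 6.2 (1)
  off `m`, McCallum Prop. 4.4 at `λ ∣ m`) — *verbatim the hypothesis `hpoints` of
  `Kolyvagin1990_sha_primary_finite_of_pointsM_of_thmA` (main case of the `p`-primary leaf), its
  last conjunct (leaf (B)) removed, with `d_K ∉ {-3,-4}` replaced by `d_K ∈ {-3,-4}` and `p ≠ 2`
  by `p ∤ 2d_K`* (over `ℚ(√-3), ℚ(i)` the group `G_ℓ` of Gross §3 has order `(ℓ+1)/u_K`, so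
  Kolyvagin's derivative (3.5) and `P_ℓ = D_ℓ y_ℓ` modulo `p^M` require `p ∤ u_K` — [K1]);
* `hR` = **(R)_M**, Kolyvagin reciprocity at every Kolyvagin prime `ℓ` of level `M` (McCallum
  Prop. 2.2 with Kolyvagin's (7.6)): an alternating left-non-degenerate biadditive pairing `e` on
  `E_{p^M}` with `e([s, F], [c', σ]) = 0` for `s ∈ S_{p^M}(E/K)`, `c'` Selmer off `ℓ` and at `∞`,
  `F` an arithmetic Frobenius at `𝔔 ∣ λ` fixing `E_{p^M}`, `σ ∈ I_𝔔`;
* `hK1`: finiteness of `Ш(E/K)[p^∞]` at the residual primes `p ∣ 2d_K` or `ρ̄_{E,p}` not onto —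
  Kolyvagin 1990 [K1], Thm. A (with Serre's bounded-index theorem; Gross §2, last paragraph).
Serre's open image theorem, the Čebotarev density theorem and the Weil pairing, hypotheses of
`Kolyvagin1990_thmA_of_hasCM_or_discr_of_leavesM_of_not_hasCM`, are now the tree's theorems
`serre_open_image_holds`, `Automorphic.chebotarev_artinRep_holds`, `exists_weilPairing_holds`;
leaf (A) is `exists_leafA_of_points` and leaf (B) is `hdual_of_kolyvaginReciprocityM`.
[cite: McCallumLMS1991, §1 Theorem (Kolyvagin), §2 Prop. 2.2, §4 (4)–(6), Lemma 4.1, Lemma 4.3, Prop. 4.4, §5 Lemma 5.3]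
[cite: GrossLMS1991, §1 Thm. 1.3 (D ≠ 3, 4), §2, §3, §4 (4.1), Props. 5.3, 5.4]
[cite: Serre1972, §4.2 Thm. 2] -/
theorem Kolyvagin1990_thmA_of_hasCM_or_discr_of_pointsM_of_not_hasCM (hE : ¬ W.HasCM)
    (hpoints : ∀ [W.IsElliptic] (_hK : IsImaginaryQuadratic K)
      (_hD : NumberField.discr K = -3 ∨ NumberField.discr K = -4)
      (_hH : SatisfiesHeegnerHypothesis N K)
      {P : (W.baseChange K).toAffine.Point} (_hP : IsHeegnerPoint N W K P)
      (_hnt : ¬ IsOfFinAddOrder P) {p : ℕ} (_hp : p.Prime)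
      (_hpD : ¬ (p : ℤ) ∣ 2 * NumberField.discr K)
      (_hρ : W.HasSurjectiveModNGaloisRep p) {M : ℕ} (_hM : 1 ≤ M)
      (hdiv : ∀ Q : geomPoints (W.baseChange K), ∃ R, ((p ^ M : ℕ) : ℤ) • R = Q)
      (c : K ≃ₐ[ℚ] K) (_hc : c ≠ 1),
      ∃ (ε : ℤ) (τ : AlgebraicClosure K ≃+* AlgebraicClosure K) (hτ : IsLiftOfAut c τ)
        (A : ℕ → AddSubgroup (geomPoints (W.baseChange K)))
        (hA : ∀ m, KolyvaginCocycle.IsAdmissible (Field.absoluteGaloisGroup K) (A m)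
          ((p ^ M : ℕ) : ℤ))
        (Pt : ℕ → geomPoints (W.baseChange K))
        (hPt : ∀ m, Pt m ∈
          KolyvaginCocycle.invPoints (Field.absoluteGaloisGroup K) (A m) ((p ^ M : ℕ) : ℤ)),
        (ε = 1 ∨ ε = -1) ∧
        IsOfFinAddOrder (Affine.Point.map (W' := W) (c : K →ₐ[ℚ] K) P - ε • P) ∧
        (∀ m, ∀ a ∈ A m, hτ.pointsMap W a ∈ A m) ∧
        Pt 1 = toGeomPoints (W.baseChange K) P ∧
        (∀ m : ℕ, Squarefree m →
          (∀ q ∈ m.primeFactors, IsKolyvaginPrime N W K p q ∧ FrobEqFrobInfty W K (p ^ M) q) →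
          (∃ B ∈ A m, hτ.pointsMap W (Pt m) =
            (ε * (-1) ^ m.primeFactors.card) • Pt m + ((p ^ M : ℕ) : ℤ) • B) ∧
          (∀ v : HeightOneSpectrum (𝓞 K), (m : 𝓞 K) ∉ v.asIdeal →
            kolyvaginClass (W.baseChange K) _ hdiv (hA m) (Pt m) (hPt m) ∈
              selmerLocalKer (W.baseChange K) (v.adicCompletion K) ((p ^ M : ℕ) : ℤ)) ∧
          (∀ ℓ : ℕ, ℓ.Prime → ℓ ∣ m → ∀ v : HeightOneSpectrum (𝓞 K), (ℓ : 𝓞 K) ∈ v.asIdeal →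
            ∀ a : ℕ, (((p : ℤ) ^ a) •
                kolyvaginClass (W.baseChange K) _ hdiv (hA m) (Pt m) (hPt m) ∈
                selmerLocalKer (W.baseChange K) (v.adicCompletion K) ((p ^ M : ℕ) : ℤ) ↔
              ((p : ℤ) ^ a) • kolyvaginClass (W.baseChange K) _ hdiv (hA (m / ℓ)) (Pt (m / ℓ))
                  (hPt (m / ℓ)) ∈
                (W.baseChange K).torsionLocalKer (v.adicCompletion K) ((p ^ M : ℕ) : ℤ)))))
    (hR : ∀ [W.IsElliptic] (_hK : IsImaginaryQuadratic K)
      (_hD : NumberField.discr K = -3 ∨ NumberField.discr K = -4)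
      (_hH : SatisfiesHeegnerHypothesis N K)
      {P : (W.baseChange K).toAffine.Point} (_hP : IsHeegnerPoint N W K P)
      (_hnt : ¬ IsOfFinAddOrder P) {p : ℕ} (_hp : p.Prime)
      (_hpD : ¬ (p : ℤ) ∣ 2 * NumberField.discr K)
      (_hρ : W.HasSurjectiveModNGaloisRep p) {M : ℕ} (_hM : 1 ≤ M)
      {ℓ : ℕ} (hℓ : IsKolyvaginPrime N W K p ℓ), FrobEqFrobInfty W K (p ^ M) ℓ →
      ∃ (A : Type u) (_ : AddCommGroup A)
        (e : geomTorsion (W.baseChange K) ((p ^ M : ℕ) : ℤ) →+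
          geomTorsion (W.baseChange K) ((p ^ M : ℕ) : ℤ) →+ A),
        (∀ x, e x x = 0) ∧ (∀ x, (∀ y, e x y = 0) → x = 0) ∧
        ∀ s ∈ selmerGroup (W.baseChange K) ((p ^ M : ℕ) : ℤ),
          ∀ c' : galH1Torsion (W.baseChange K) ((p ^ M : ℕ) : ℤ),
          (∀ v : HeightOneSpectrum (𝓞 K), (ℓ : 𝓞 K) ∉ v.asIdeal →
            c' ∈ selmerLocalKer (W.baseChange K) (v.adicCompletion K) ((p ^ M : ℕ) : ℤ)) →
          (∀ w : InfinitePlace K,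
            c' ∈ selmerLocalKer (W.baseChange K) w.Completion ((p ^ M : ℕ) : ℤ)) →
          ∀ 𝔔 ∈ hℓ.place.primesAbove, ∀ F : absoluteGaloisGroup K, IsArithFrobAt (𝓞 K) F 𝔔 →
            F ∈ torsionFixing (W.baseChange K) ((p ^ M : ℕ) : ℤ) →
            ∀ σ ∈ 𝔔.inertia (absoluteGaloisGroup K),
            e (h1Eval (W.baseChange K) ((p ^ M : ℕ) : ℤ) s F)
              (h1Eval (W.baseChange K) ((p ^ M : ℕ) : ℤ) c' σ) = 0)
    (hK1 : ∀ [W.IsElliptic] (_hK : IsImaginaryQuadratic K)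
      (_hD : NumberField.discr K = -3 ∨ NumberField.discr K = -4)
      (_hH : SatisfiesHeegnerHypothesis N K) {P : (W.baseChange K).toAffine.Point}
      (_hP : IsHeegnerPoint N W K P) (_hnt : ¬ IsOfFinAddOrder P) (p : ℕ) (_hp : p.Prime),
      ((p : ℤ) ∣ 2 * NumberField.discr K ∨ ¬ W.HasSurjectiveModNGaloisRep p) →
      Set.Finite {c : (W.baseChange K).sha | ∃ j : ℕ, p ^ j • c = 0}) :
    Kolyvagin1990_thmA_of_hasCM_or_discr N W K := by
  refine Kolyvagin1990_thmA_of_hasCM_or_discr_of_leavesM_of_not_hasCM N W K hE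
    serre_open_image_holds Automorphic.chebotarev_artinRep_holds
    (fun p _ ↦ exists_weilPairing_holds W p) ?_ hK1
  intro _ hK hD hH P hP hnt p hp hpD hρ M hM hdiv c hc
  have hp2 : p ≠ 2 := by
    rintro rfl
    exact hpD (dvd_mul_right 2 _)
  obtain ⟨ε, τ, hτ, A, hA, Pt, hPt, hε, h53, hAτ, hPt1, hm⟩ :=
    hpoints hK hD hH hP hnt hp hpD hρ hM hdiv c hc
  obtain ⟨cl, hc1, hcl⟩ := exists_leafA_of_points (N := N) hdiv c hτ ε A hA hAτ Pt hPt hPt1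
    (fun m hm' hk ↦ (hm m hm' hk).1) (fun m hm' hk ↦ (hm m hm' hk).2.1)
    (fun m hm' hk ↦ (hm m hm' hk).2.2)
  exact ⟨ε, cl, hε, h53, hc1, hcl, hdual_of_kolyvaginReciprocityM W hK hP hp hp2 hM hc
    (fun hℓ hfr ↦ hR hK hD hH hP hnt hp hpD hρ hM hℓ hfr)⟩

/-- **`Kolyvagin1990_thmA_of_hasCM_or_discr` from Heegner-type points, Kolyvagin reciprocity,
Cor. 3.2 and [K1] at the residual primes — the CM-capable form.** In the excluded cases (`E`
with CM, or `d_K ∈ {-3, -4}`), whenever the Heegner point `P = y_K` has infinite order, suppose: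
* `hR` = **(R)_M** for every odd `p`, every `M ≥ 1` and every Kolyvagin prime `ℓ` of level `M`
  (McCallum Prop. 2.2 with Kolyvagin's (7.6); no hypothesis on `End(E)`);
* `h`: a finite (bounded) residual set of primes `R` and, for every prime `p ∉ R`: `p ≠ 2`,
  `E(K)[p] = 0`, and for every `M ≥ 1` and the complex conjugation `c ≠ 1`: McCallum's Cor. 3.2
  for `H¹(K, E_{p^M})` (**(C)**, the shape of the `cebotarev` field — for `E` with CM by
  `R ⊂ F` to be proved for the image `Gal(F(E_p)/F) = Aut_R(E_p)`, McCallum §1, §3) and the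
  point-level leaf **(A')** (`ε`, `τ`, `A_m`, `P_m` with McCallum's (4), `P_1 = y_K`, Gross's
  Prop. 5.4 (1), McCallum's Lemma 4.3 and Prop. 4.4 for the classes of the `P_m`); and for
  `p ∈ R` the finiteness of `Ш(E/K)[p^∞]` (Kolyvagin 1990 [K1] at the inadmissible primes).
Then `rank E(K) = 1` and `Ш(E/K)` is finite: the classes `c_M(m)` with McCallum's (6) and Gross's
Prop. 5.4 (2) are `exists_leafA_of_points`, leaf (B) is `hdual_of_kolyvaginReciprocityM`, and
`Kolyvagin1990_thmA_of_hasCM_or_discr_of_localDataM` concludes.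
[cite: McCallumLMS1991, §1 Theorem (Kolyvagin), §2 Prop. 2.2, §3 Cor. 3.2, §4 (4)–(6), Lemma 4.1, Lemma 4.3, Prop. 4.4, §5 Lemma 5.3]
[cite: GrossLMS1991, §1 Thm. 1.3, §2, §4 (4.1), Props. 5.3, 5.4] -/
theorem Kolyvagin1990_thmA_of_hasCM_or_discr_of_pointsM_of_localDataM
    (hR : ∀ [W.IsElliptic] (_hK : IsImaginaryQuadratic K) (_hH : SatisfiesHeegnerHypothesis N K)
      {P : (W.baseChange K).toAffine.Point} (_hP : IsHeegnerPoint N W K P)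
      (_hnt : ¬ IsOfFinAddOrder P) {p : ℕ} (_hp : p.Prime) (_hp2 : p ≠ 2) {M : ℕ} (_hM : 1 ≤ M)
      {ℓ : ℕ} (hℓ : IsKolyvaginPrime N W K p ℓ), FrobEqFrobInfty W K (p ^ M) ℓ →
      ∃ (A : Type u) (_ : AddCommGroup A)
        (e : geomTorsion (W.baseChange K) ((p ^ M : ℕ) : ℤ) →+
          geomTorsion (W.baseChange K) ((p ^ M : ℕ) : ℤ) →+ A),
        (∀ x, e x x = 0) ∧ (∀ x, (∀ y, e x y = 0) → x = 0) ∧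
        ∀ s ∈ selmerGroup (W.baseChange K) ((p ^ M : ℕ) : ℤ),
          ∀ c' : galH1Torsion (W.baseChange K) ((p ^ M : ℕ) : ℤ),
          (∀ v : HeightOneSpectrum (𝓞 K), (ℓ : 𝓞 K) ∉ v.asIdeal →
            c' ∈ selmerLocalKer (W.baseChange K) (v.adicCompletion K) ((p ^ M : ℕ) : ℤ)) →
          (∀ w : InfinitePlace K,
            c' ∈ selmerLocalKer (W.baseChange K) w.Completion ((p ^ M : ℕ) : ℤ)) →
          ∀ 𝔔 ∈ hℓ.place.primesAbove, ∀ F : absoluteGaloisGroup K, IsArithFrobAt (𝓞 K) F 𝔔 →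
            F ∈ torsionFixing (W.baseChange K) ((p ^ M : ℕ) : ℤ) →
            ∀ σ ∈ 𝔔.inertia (absoluteGaloisGroup K),
            e (h1Eval (W.baseChange K) ((p ^ M : ℕ) : ℤ) s F)
              (h1Eval (W.baseChange K) ((p ^ M : ℕ) : ℤ) c' σ) = 0)
    (h : ∀ [W.IsElliptic]
      (_hexc : W.HasCM ∨ NumberField.discr K = -3 ∨ NumberField.discr K = -4)
      (_hK : IsImaginaryQuadratic K) (_hH : SatisfiesHeegnerHypothesis N K)
      {P : (W.baseChange K).toAffine.Point} (_hP : IsHeegnerPoint N W K P)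
      (_hnt : ¬ IsOfFinAddOrder P),
      ∃ R : ℕ → Prop, (∃ B : ℕ, ∀ p : ℕ, p.Prime → B ≤ p → ¬ R p) ∧
        (∀ (p : ℕ) (_hp : p.Prime) (_hRp : ¬ R p), p ≠ 2 ∧
          AddSubgroup.torsionBy (W.baseChange K).toAffine.Point (p : ℤ) = ⊥ ∧
          ∀ (M : ℕ) (_hM : 1 ≤ M)
            (hdiv : ∀ Q : geomPoints (W.baseChange K), ∃ R', ((p ^ M : ℕ) : ℤ) • R' = Q)
            (c : K ≃ₐ[ℚ] K) (_hc : c ≠ 1),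
            (∀ (r : ℕ) (cs : Fin r → galH1Torsion (W.baseChange K) ((p ^ M : ℕ) : ℤ))
              (Nv : Fin r → ℕ), (∀ i, cs i ≠ 0) →
              (∀ i, Nv i ≠ 0 → ((p : ℤ) ^ (Nv i - 1)) • cs i ≠ 0) →
              (∀ i, ∃ e : ℤ, (e = 1 ∨ e = -1) ∧
                conjAct W c ((p ^ M : ℕ) : ℤ) (cs i) = e • cs i) →
              (∀ a : Fin r → ℤ, ∑ i, a i • cs i = 0 → ∀ i, a i • cs i = 0) →
              ∀ b : ℕ, ∃ ℓ : ℕ, b < ℓ ∧ IsKolyvaginPrime N W K p ℓ ∧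
                FrobEqFrobInfty W K (p ^ M) ℓ ∧
                ∀ i, ∀ v : HeightOneSpectrum (𝓞 K), (ℓ : 𝓞 K) ∈ v.asIdeal →
                  (((p : ℤ) ^ Nv i) • cs i ∈
                      (W.baseChange K).torsionLocalKer (v.adicCompletion K) ((p ^ M : ℕ) : ℤ) ∧
                    (Nv i ≠ 0 → ((p : ℤ) ^ (Nv i - 1)) • cs i ∉
                      (W.baseChange K).torsionLocalKer (v.adicCompletion K)
                        ((p ^ M : ℕ) : ℤ)))) ∧
            ∃ (ε : ℤ) (τ : AlgebraicClosure K ≃+* AlgebraicClosure K) (hτ : IsLiftOfAut c τ)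
              (A : ℕ → AddSubgroup (geomPoints (W.baseChange K)))
              (hA : ∀ m, KolyvaginCocycle.IsAdmissible (Field.absoluteGaloisGroup K) (A m)
                ((p ^ M : ℕ) : ℤ))
              (Pt : ℕ → geomPoints (W.baseChange K))
              (hPt : ∀ m, Pt m ∈
                KolyvaginCocycle.invPoints (Field.absoluteGaloisGroup K) (A m)
                  ((p ^ M : ℕ) : ℤ)),
              (ε = 1 ∨ ε = -1) ∧
              IsOfFinAddOrder (Affine.Point.map (W' := W) (c : K →ₐ[ℚ] K) P - ε • P) ∧
              (∀ m, ∀ a ∈ A m, hτ.pointsMap W a ∈ A m) ∧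
              Pt 1 = toGeomPoints (W.baseChange K) P ∧
              (∀ m : ℕ, Squarefree m →
                (∀ q ∈ m.primeFactors,
                  IsKolyvaginPrime N W K p q ∧ FrobEqFrobInfty W K (p ^ M) q) →
                (∃ B ∈ A m, hτ.pointsMap W (Pt m) =
                  (ε * (-1) ^ m.primeFactors.card) • Pt m + ((p ^ M : ℕ) : ℤ) • B) ∧
                (∀ v : HeightOneSpectrum (𝓞 K), (m : 𝓞 K) ∉ v.asIdeal →
                  kolyvaginClass (W.baseChange K) _ hdiv (hA m) (Pt m) (hPt m) ∈
                    selmerLocalKer (W.baseChange K) (v.adicCompletion K) ((p ^ M : ℕ) : ℤ)) ∧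
                (∀ ℓ : ℕ, ℓ.Prime → ℓ ∣ m → ∀ v : HeightOneSpectrum (𝓞 K),
                  (ℓ : 𝓞 K) ∈ v.asIdeal →
                  ∀ a : ℕ, (((p : ℤ) ^ a) •
                      kolyvaginClass (W.baseChange K) _ hdiv (hA m) (Pt m) (hPt m) ∈
                      selmerLocalKer (W.baseChange K) (v.adicCompletion K) ((p ^ M : ℕ) : ℤ) ↔
                    ((p : ℤ) ^ a) •
                        kolyvaginClass (W.baseChange K) _ hdiv (hA (m / ℓ)) (Pt (m / ℓ))
                          (hPt (m / ℓ)) ∈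
                      (W.baseChange K).torsionLocalKer (v.adicCompletion K)
                        ((p ^ M : ℕ) : ℤ))))) ∧
        (∀ p : ℕ, p.Prime → R p →
          Set.Finite {c : (W.baseChange K).sha | ∃ j : ℕ, p ^ j • c = 0})) :
    Kolyvagin1990_thmA_of_hasCM_or_discr N W K := by
  refine Kolyvagin1990_thmA_of_hasCM_or_discr_of_localDataM N W K ?_
  intro _ hexc hK hH P hP hnt
  obtain ⟨R, hRb, hdata, hres⟩ := h hexc hK hH hP hnt
  refine ⟨R, hRb, fun p hp hRp ↦ ?_, hres⟩
  obtain ⟨hp2, hbot, hlev⟩ := hdata p hp hRp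
  refine ⟨hp2, hbot, fun M hM hdiv c hc ↦ ?_⟩
  obtain ⟨hceb, ε, τ, hτ, A, hA, Pt, hPt, hε, h53, hAτ, hPt1, hm⟩ := hlev M hM hdiv c hc
  obtain ⟨cl, hc1, hcl⟩ := exists_leafA_of_points (N := N) hdiv c hτ ε A hA hAτ Pt hPt hPt1
    (fun m hm' hk ↦ (hm m hm' hk).1) (fun m hm' hk ↦ (hm m hm' hk).2.1)
    (fun m hm' hk ↦ (hm m hm' hk).2.2)
  exact ⟨hceb, ε, cl, hε, h53, hc1, hcl, hdual_of_kolyvaginReciprocityM W hK hP hp hp2 hM hc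
    (fun hℓ hfr ↦ hR hK hH hP hnt hp hp2 hM hℓ hfr)⟩

/-- **`Kolyvagin1990_thmA_of_hasCM_or_discr` from points and reciprocity — combined form,
listing in one statement everything the direct (Euler-system) route of the leaf now rests on.**
* `hR`: Kolyvagin reciprocity (R)_M at every Kolyvagin prime of level `M`, every odd `p`,
  every `M ≥ 1` (McCallum Prop. 2.2 with Kolyvagin's (7.6)) — shared by both cases;
* for `E` without CM (so `d_K ∈ {-3, -4}`): the point-level leaf (A') at the primes `p ∤ 2d_K`
  with `ρ̄_{E,p}` onto (`hpoints`) and Kolyvagin's [K1] at the residual primes (`hK1`) —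
  `Kolyvagin1990_thmA_of_hasCM_or_discr_of_pointsM_of_not_hasCM`;
* for `E` with CM: off a finite residual set of primes, `p ≠ 2`, `E(K)[p] = 0`, Cor. 3.2 at
  level `p^M` for the CM image and the point-level leaf (A'); [K1] on it (`hCM`) —
  `Kolyvagin1990_thmA_of_hasCM_or_discr_of_pointsM_of_localDataM`.
Nothing else: Serre's open image theorem, Čebotarev, the Weil pairing, McCallum's cocycle and
(6), Gross's Prop. 5.4 (2), McCallum's Lemmas 5.1 and 5.3, Gross's §10 modulo `p^M`, Prop. 2.3 ⇒
Prop. 2.1, the passage to `Ш[p^∞]` and to `Ш`, and (for `E` without CM) Cor. 3.2 at every level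
and `E(K)[p] = 0` are theorems of the tree.
[cite: McCallumLMS1991, §1 Theorem (Kolyvagin), §§2–5] [cite: GrossLMS1991, §1 Thm. 1.3, §2]
[cite: Serre1972, §4.2 Thm. 2] -/
theorem Kolyvagin1990_thmA_of_hasCM_or_discr_of_pointsM
    (hR : ∀ [W.IsElliptic] (_hK : IsImaginaryQuadratic K) (_hH : SatisfiesHeegnerHypothesis N K)
      {P : (W.baseChange K).toAffine.Point} (_hP : IsHeegnerPoint N W K P)
      (_hnt : ¬ IsOfFinAddOrder P) {p : ℕ} (_hp : p.Prime) (_hp2 : p ≠ 2) {M : ℕ} (_hM : 1 ≤ M)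
      {ℓ : ℕ} (hℓ : IsKolyvaginPrime N W K p ℓ), FrobEqFrobInfty W K (p ^ M) ℓ →
      ∃ (A : Type u) (_ : AddCommGroup A)
        (e : geomTorsion (W.baseChange K) ((p ^ M : ℕ) : ℤ) →+
          geomTorsion (W.baseChange K) ((p ^ M : ℕ) : ℤ) →+ A),
        (∀ x, e x x = 0) ∧ (∀ x, (∀ y, e x y = 0) → x = 0) ∧
        ∀ s ∈ selmerGroup (W.baseChange K) ((p ^ M : ℕ) : ℤ),
          ∀ c' : galH1Torsion (W.baseChange K) ((p ^ M : ℕ) : ℤ),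
          (∀ v : HeightOneSpectrum (𝓞 K), (ℓ : 𝓞 K) ∉ v.asIdeal →
            c' ∈ selmerLocalKer (W.baseChange K) (v.adicCompletion K) ((p ^ M : ℕ) : ℤ)) →
          (∀ w : InfinitePlace K,
            c' ∈ selmerLocalKer (W.baseChange K) w.Completion ((p ^ M : ℕ) : ℤ)) →
          ∀ 𝔔 ∈ hℓ.place.primesAbove, ∀ F : absoluteGaloisGroup K, IsArithFrobAt (𝓞 K) F 𝔔 →
            F ∈ torsionFixing (W.baseChange K) ((p ^ M : ℕ) : ℤ) →
            ∀ σ ∈ 𝔔.inertia (absoluteGaloisGroup K),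
            e (h1Eval (W.baseChange K) ((p ^ M : ℕ) : ℤ) s F)
              (h1Eval (W.baseChange K) ((p ^ M : ℕ) : ℤ) c' σ) = 0)
    (hpoints : ∀ [W.IsElliptic] (_hE : ¬ W.HasCM) (_hK : IsImaginaryQuadratic K)
      (_hD : NumberField.discr K = -3 ∨ NumberField.discr K = -4)
      (_hH : SatisfiesHeegnerHypothesis N K)
      {P : (W.baseChange K).toAffine.Point} (_hP : IsHeegnerPoint N W K P)
      (_hnt : ¬ IsOfFinAddOrder P) {p : ℕ} (_hp : p.Prime)
      (_hpD : ¬ (p : ℤ) ∣ 2 * NumberField.discr K)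
      (_hρ : W.HasSurjectiveModNGaloisRep p) {M : ℕ} (_hM : 1 ≤ M)
      (hdiv : ∀ Q : geomPoints (W.baseChange K), ∃ R, ((p ^ M : ℕ) : ℤ) • R = Q)
      (c : K ≃ₐ[ℚ] K) (_hc : c ≠ 1),
      ∃ (ε : ℤ) (τ : AlgebraicClosure K ≃+* AlgebraicClosure K) (hτ : IsLiftOfAut c τ)
        (A : ℕ → AddSubgroup (geomPoints (W.baseChange K)))
        (hA : ∀ m, KolyvaginCocycle.IsAdmissible (Field.absoluteGaloisGroup K) (A m)
          ((p ^ M : ℕ) : ℤ))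
        (Pt : ℕ → geomPoints (W.baseChange K))
        (hPt : ∀ m, Pt m ∈
          KolyvaginCocycle.invPoints (Field.absoluteGaloisGroup K) (A m) ((p ^ M : ℕ) : ℤ)),
        (ε = 1 ∨ ε = -1) ∧
        IsOfFinAddOrder (Affine.Point.map (W' := W) (c : K →ₐ[ℚ] K) P - ε • P) ∧
        (∀ m, ∀ a ∈ A m, hτ.pointsMap W a ∈ A m) ∧
        Pt 1 = toGeomPoints (W.baseChange K) P ∧
        (∀ m : ℕ, Squarefree m →
          (∀ q ∈ m.primeFactors, IsKolyvaginPrime N W K p q ∧ FrobEqFrobInfty W K (p ^ M) q) →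
          (∃ B ∈ A m, hτ.pointsMap W (Pt m) =
            (ε * (-1) ^ m.primeFactors.card) • Pt m + ((p ^ M : ℕ) : ℤ) • B) ∧
          (∀ v : HeightOneSpectrum (𝓞 K), (m : 𝓞 K) ∉ v.asIdeal →
            kolyvaginClass (W.baseChange K) _ hdiv (hA m) (Pt m) (hPt m) ∈
              selmerLocalKer (W.baseChange K) (v.adicCompletion K) ((p ^ M : ℕ) : ℤ)) ∧
          (∀ ℓ : ℕ, ℓ.Prime → ℓ ∣ m → ∀ v : HeightOneSpectrum (𝓞 K), (ℓ : 𝓞 K) ∈ v.asIdeal →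
            ∀ a : ℕ, (((p : ℤ) ^ a) •
                kolyvaginClass (W.baseChange K) _ hdiv (hA m) (Pt m) (hPt m) ∈
                selmerLocalKer (W.baseChange K) (v.adicCompletion K) ((p ^ M : ℕ) : ℤ) ↔
              ((p : ℤ) ^ a) • kolyvaginClass (W.baseChange K) _ hdiv (hA (m / ℓ)) (Pt (m / ℓ))
                  (hPt (m / ℓ)) ∈
                (W.baseChange K).torsionLocalKer (v.adicCompletion K) ((p ^ M : ℕ) : ℤ)))))
    (hK1 : ∀ [W.IsElliptic] (_hE : ¬ W.HasCM) (_hK : IsImaginaryQuadratic K)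
      (_hD : NumberField.discr K = -3 ∨ NumberField.discr K = -4)
      (_hH : SatisfiesHeegnerHypothesis N K) {P : (W.baseChange K).toAffine.Point}
      (_hP : IsHeegnerPoint N W K P) (_hnt : ¬ IsOfFinAddOrder P) (p : ℕ) (_hp : p.Prime),
      ((p : ℤ) ∣ 2 * NumberField.discr K ∨ ¬ W.HasSurjectiveModNGaloisRep p) →
      Set.Finite {c : (W.baseChange K).sha | ∃ j : ℕ, p ^ j • c = 0})
    (hCM : ∀ [W.IsElliptic] (_hE : W.HasCM)
      (_hK : IsImaginaryQuadratic K) (_hH : SatisfiesHeegnerHypothesis N K)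
      {P : (W.baseChange K).toAffine.Point} (_hP : IsHeegnerPoint N W K P)
      (_hnt : ¬ IsOfFinAddOrder P),
      ∃ R : ℕ → Prop, (∃ B : ℕ, ∀ p : ℕ, p.Prime → B ≤ p → ¬ R p) ∧
        (∀ (p : ℕ) (_hp : p.Prime) (_hRp : ¬ R p), p ≠ 2 ∧
          AddSubgroup.torsionBy (W.baseChange K).toAffine.Point (p : ℤ) = ⊥ ∧
          ∀ (M : ℕ) (_hM : 1 ≤ M)
            (hdiv : ∀ Q : geomPoints (W.baseChange K), ∃ R', ((p ^ M : ℕ) : ℤ) • R' = Q)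
            (c : K ≃ₐ[ℚ] K) (_hc : c ≠ 1),
            (∀ (r : ℕ) (cs : Fin r → galH1Torsion (W.baseChange K) ((p ^ M : ℕ) : ℤ))
              (Nv : Fin r → ℕ), (∀ i, cs i ≠ 0) →
              (∀ i, Nv i ≠ 0 → ((p : ℤ) ^ (Nv i - 1)) • cs i ≠ 0) →
              (∀ i, ∃ e : ℤ, (e = 1 ∨ e = -1) ∧
                conjAct W c ((p ^ M : ℕ) : ℤ) (cs i) = e • cs i) →
              (∀ a : Fin r → ℤ, ∑ i, a i • cs i = 0 → ∀ i, a i • cs i = 0) →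
              ∀ b : ℕ, ∃ ℓ : ℕ, b < ℓ ∧ IsKolyvaginPrime N W K p ℓ ∧
                FrobEqFrobInfty W K (p ^ M) ℓ ∧
                ∀ i, ∀ v : HeightOneSpectrum (𝓞 K), (ℓ : 𝓞 K) ∈ v.asIdeal →
                  (((p : ℤ) ^ Nv i) • cs i ∈
                      (W.baseChange K).torsionLocalKer (v.adicCompletion K) ((p ^ M : ℕ) : ℤ) ∧
                    (Nv i ≠ 0 → ((p : ℤ) ^ (Nv i - 1)) • cs i ∉
                      (W.baseChange K).torsionLocalKer (v.adicCompletion K)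
                        ((p ^ M : ℕ) : ℤ)))) ∧
            ∃ (ε : ℤ) (τ : AlgebraicClosure K ≃+* AlgebraicClosure K) (hτ : IsLiftOfAut c τ)
              (A : ℕ → AddSubgroup (geomPoints (W.baseChange K)))
              (hA : ∀ m, KolyvaginCocycle.IsAdmissible (Field.absoluteGaloisGroup K) (A m)
                ((p ^ M : ℕ) : ℤ))
              (Pt : ℕ → geomPoints (W.baseChange K))
              (hPt : ∀ m, Pt m ∈
                KolyvaginCocycle.invPoints (Field.absoluteGaloisGroup K) (A m)
                  ((p ^ M : ℕ) : ℤ)),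
              (ε = 1 ∨ ε = -1) ∧
              IsOfFinAddOrder (Affine.Point.map (W' := W) (c : K →ₐ[ℚ] K) P - ε • P) ∧
              (∀ m, ∀ a ∈ A m, hτ.pointsMap W a ∈ A m) ∧
              Pt 1 = toGeomPoints (W.baseChange K) P ∧
              (∀ m : ℕ, Squarefree m →
                (∀ q ∈ m.primeFactors,
                  IsKolyvaginPrime N W K p q ∧ FrobEqFrobInfty W K (p ^ M) q) →
                (∃ B ∈ A m, hτ.pointsMap W (Pt m) =
                  (ε * (-1) ^ m.primeFactors.card) • Pt m + ((p ^ M : ℕ) : ℤ) • B) ∧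
                (∀ v : HeightOneSpectrum (𝓞 K), (m : 𝓞 K) ∉ v.asIdeal →
                  kolyvaginClass (W.baseChange K) _ hdiv (hA m) (Pt m) (hPt m) ∈
                    selmerLocalKer (W.baseChange K) (v.adicCompletion K) ((p ^ M : ℕ) : ℤ)) ∧
                (∀ ℓ : ℕ, ℓ.Prime → ℓ ∣ m → ∀ v : HeightOneSpectrum (𝓞 K),
                  (ℓ : 𝓞 K) ∈ v.asIdeal →
                  ∀ a : ℕ, (((p : ℤ) ^ a) •
                      kolyvaginClass (W.baseChange K) _ hdiv (hA m) (Pt m) (hPt m) ∈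
                      selmerLocalKer (W.baseChange K) (v.adicCompletion K) ((p ^ M : ℕ) : ℤ) ↔
                    ((p : ℤ) ^ a) •
                        kolyvaginClass (W.baseChange K) _ hdiv (hA (m / ℓ)) (Pt (m / ℓ))
                          (hPt (m / ℓ)) ∈
                      (W.baseChange K).torsionLocalKer (v.adicCompletion K)
                        ((p ^ M : ℕ) : ℤ))))) ∧
        (∀ p : ℕ, p.Prime → R p →
          Set.Finite {c : (W.baseChange K).sha | ∃ j : ℕ, p ^ j • c = 0})) :
    Kolyvagin1990_thmA_of_hasCM_or_discr N W K := by
  by_cases hE : W.HasCM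
  · refine Kolyvagin1990_thmA_of_hasCM_or_discr_of_pointsM_of_localDataM N W K hR ?_
    intro _ _ hK hH P hP hnt
    exact hCM hE hK hH hP hnt
  · refine Kolyvagin1990_thmA_of_hasCM_or_discr_of_pointsM_of_not_hasCM N W K hE ?_ ?_ ?_
    · intro _ hK hD hH P hP hnt p hp hpD hρ M hM hdiv c hc
      exact hpoints hE hK hD hH hP hnt hp hpD hρ hM hdiv c hc
    · intro _ hK _ hH P hP hnt p hp hpD _ M hM ℓ hℓ hfr
      have hp2 : p ≠ 2 := by
        rintro rfl
        exact hpD (dvd_mul_right 2 _)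
      exact hR hK hH hP hnt hp hp2 hM hℓ hfr
    · intro _ hK hD hH P hP hnt p hp hres
      exact hK1 hE hK hD hH hP hnt p hp hres

end Exceptional

/-! ## Kolyvagin's theorem itself from points and reciprocity, over every `K` -/

section AllFields

variable (N : ℕ) [NeZero N] (W : WeierstrassCurve ℚ) (K : Type u) [Field K] [NumberField K]

/-- **Kolyvagin's Theorem A (`kolyvagin N W K`) for a curve without CM over EVERY imaginary
quadratic `K`, from Heegner-type points, Kolyvagin reciprocity and [K1] at the residual primes.**
For `E = W` without complex multiplication and any `K` (the main case `d_K ∉ {-3, -4}` of Gross's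
text and the two fields `ℚ(√-3)`, `ℚ(i)` alike), Theorem A — *`y_K` of infinite order ⇒
`rank E(K) = 1` and `Ш(E/K)` finite* — follows from:
* `hpoints` = leaf **(A')** at every prime `p ≠ 2`, `p ≠ 3` if `d_K = -3` (i.e. `p ∤ 2u_K`,
  `u_K = #𝒪_K^×/2`), with `ρ̄_{E,p}` onto, every `M ≥ 1` and the complex conjugation `c ≠ 1`:
  `ε`, a lift `τ` of `c`, `Γ_K`- and `τ`-stable `p^M`-torsion-free `A_m ⊆ E(K̄)` (Gross Lemma 4.3)
  with points `P_m`, `[P_m] ∈ (A_m/p^M)^{Γ_K}` (McCallum (4)), `P_1 = y_K`, Gross's Prop. 5.3 and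
  Prop. 5.4 (1), and McCallum's Lemma 4.3 / Prop. 4.4 for the classes of the `P_m` — the shape of
  `Kolyvagin1990_sha_primary_finite_of_pointsM_of_thmA`;
* `hR` = **(R)_M**, Kolyvagin reciprocity at `λ` for every odd `p` and `M ≥ 1` (McCallum Prop. 2.2
  with Kolyvagin's (7.6));
* `hK1`: `Ш(E/K)[p^∞]` finite at the residual primes `p = 2`, `p = 3 = u_K` (when `d_K = -3`), or
  `ρ̄_{E,p}` not onto — Kolyvagin 1990 [K1], Thm. A; finitely many by Serre's theorem
  (`serre_open_image_holds`).
Proof (Gross §2 and McCallum §5 at every level, assembled by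
`WeierstrassCurve.mordellWeilRank_eq_one_and_shaFinite_of_hypothesesM`): off the residual set,
`E(K)[p] = 0` (`torsionBy_eq_bot_of_isImaginaryQuadratic`), `M₀, x₀` from McCallum's Lemma 5.1
(`exists_kummer_generator_pow`), the classes from `exists_leafA_of_points`, leaf (B) from
`hdual_of_kolyvaginReciprocityM`, the data from `exists_hypothesesM_of_leavesM` (Cor. 3.2 at
level `p^M` being `McCallum1991_cor_3_2_pow_of_chebotarev` with `chebotarev_artinRep_holds` and
`exists_weilPairing_holds`). In particular the level-`p` named facts `Gross1991_prop_2_1`,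
`Gross1991_kolyvaginClasses`, `Gross1991_prop_8_2` and both leaves
`Kolyvagin1990_sha_primary_finite`, `Kolyvagin1990_thmA_of_hasCM_or_discr` of
`kolyvagin_of_Gross1991` are bypassed for non-CM curves (the two leaves are recovered from the
conclusion by `Kolyvagin1990_sha_primary_finite_of_kolyvagin` and
`Kolyvagin1990_thmA_of_hasCM_or_discr_of_kolyvagin`; Prop. 2.1 is the level-`1`, `M₀ = 0` case of
the same data, `HypothesesM.natCard_sel_of_M_eq_one` with
`WeierstrassCurve.mordellWeilRank_eq_one_of_card_selmerGroup`).
[cite: McCallumLMS1991, §1 Theorem (Kolyvagin), §2 Prop. 2.2, §3 Cor. 3.2, §4 (4)–(6), Lemma 4.1, Lemma 4.3, Prop. 4.4, §5 Lemma 5.1, Lemma 5.3]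
[cite: GrossLMS1991, §1 Thm. 1.3, §2 (Props. 2.1, 2.3), §3, §4 (4.1), Props. 5.3, 5.4]
[cite: Serre1972, §4.2 Thm. 2] -/
theorem kolyvagin_of_pointsM_of_not_hasCM (hE : ¬ W.HasCM)
    (hpoints : ∀ [W.IsElliptic] (_hK : IsImaginaryQuadratic K)
      (_hH : SatisfiesHeegnerHypothesis N K)
      {P : (W.baseChange K).toAffine.Point} (_hP : IsHeegnerPoint N W K P)
      (_hnt : ¬ IsOfFinAddOrder P) {p : ℕ} (_hp : p.Prime) (_hp2 : p ≠ 2)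
      (_hp3 : NumberField.discr K = -3 → p ≠ 3)
      (_hρ : W.HasSurjectiveModNGaloisRep p) {M : ℕ} (_hM : 1 ≤ M)
      (hdiv : ∀ Q : geomPoints (W.baseChange K), ∃ R, ((p ^ M : ℕ) : ℤ) • R = Q)
      (c : K ≃ₐ[ℚ] K) (_hc : c ≠ 1),
      ∃ (ε : ℤ) (τ : AlgebraicClosure K ≃+* AlgebraicClosure K) (hτ : IsLiftOfAut c τ)
        (A : ℕ → AddSubgroup (geomPoints (W.baseChange K)))
        (hA : ∀ m, KolyvaginCocycle.IsAdmissible (Field.absoluteGaloisGroup K) (A m)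
          ((p ^ M : ℕ) : ℤ))
        (Pt : ℕ → geomPoints (W.baseChange K))
        (hPt : ∀ m, Pt m ∈
          KolyvaginCocycle.invPoints (Field.absoluteGaloisGroup K) (A m) ((p ^ M : ℕ) : ℤ)),
        (ε = 1 ∨ ε = -1) ∧
        IsOfFinAddOrder (Affine.Point.map (W' := W) (c : K →ₐ[ℚ] K) P - ε • P) ∧
        (∀ m, ∀ a ∈ A m, hτ.pointsMap W a ∈ A m) ∧
        Pt 1 = toGeomPoints (W.baseChange K) P ∧
        (∀ m : ℕ, Squarefree m →
          (∀ q ∈ m.primeFactors, IsKolyvaginPrime N W K p q ∧ FrobEqFrobInfty W K (p ^ M) q) →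
          (∃ B ∈ A m, hτ.pointsMap W (Pt m) =
            (ε * (-1) ^ m.primeFactors.card) • Pt m + ((p ^ M : ℕ) : ℤ) • B) ∧
          (∀ v : HeightOneSpectrum (𝓞 K), (m : 𝓞 K) ∉ v.asIdeal →
            kolyvaginClass (W.baseChange K) _ hdiv (hA m) (Pt m) (hPt m) ∈
              selmerLocalKer (W.baseChange K) (v.adicCompletion K) ((p ^ M : ℕ) : ℤ)) ∧
          (∀ ℓ : ℕ, ℓ.Prime → ℓ ∣ m → ∀ v : HeightOneSpectrum (𝓞 K), (ℓ : 𝓞 K) ∈ v.asIdeal →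
            ∀ a : ℕ, (((p : ℤ) ^ a) •
                kolyvaginClass (W.baseChange K) _ hdiv (hA m) (Pt m) (hPt m) ∈
                selmerLocalKer (W.baseChange K) (v.adicCompletion K) ((p ^ M : ℕ) : ℤ) ↔
              ((p : ℤ) ^ a) • kolyvaginClass (W.baseChange K) _ hdiv (hA (m / ℓ)) (Pt (m / ℓ))
                  (hPt (m / ℓ)) ∈
                (W.baseChange K).torsionLocalKer (v.adicCompletion K) ((p ^ M : ℕ) : ℤ)))))
    (hR : ∀ [W.IsElliptic] (_hK : IsImaginaryQuadratic K) (_hH : SatisfiesHeegnerHypothesis N K)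
      {P : (W.baseChange K).toAffine.Point} (_hP : IsHeegnerPoint N W K P)
      (_hnt : ¬ IsOfFinAddOrder P) {p : ℕ} (_hp : p.Prime) (_hp2 : p ≠ 2) {M : ℕ} (_hM : 1 ≤ M)
      {ℓ : ℕ} (hℓ : IsKolyvaginPrime N W K p ℓ), FrobEqFrobInfty W K (p ^ M) ℓ →
      ∃ (A : Type u) (_ : AddCommGroup A)
        (e : geomTorsion (W.baseChange K) ((p ^ M : ℕ) : ℤ) →+
          geomTorsion (W.baseChange K) ((p ^ M : ℕ) : ℤ) →+ A),
        (∀ x, e x x = 0) ∧ (∀ x, (∀ y, e x y = 0) → x = 0) ∧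
        ∀ s ∈ selmerGroup (W.baseChange K) ((p ^ M : ℕ) : ℤ),
          ∀ c' : galH1Torsion (W.baseChange K) ((p ^ M : ℕ) : ℤ),
          (∀ v : HeightOneSpectrum (𝓞 K), (ℓ : 𝓞 K) ∉ v.asIdeal →
            c' ∈ selmerLocalKer (W.baseChange K) (v.adicCompletion K) ((p ^ M : ℕ) : ℤ)) →
          (∀ w : InfinitePlace K,
            c' ∈ selmerLocalKer (W.baseChange K) w.Completion ((p ^ M : ℕ) : ℤ)) →
          ∀ 𝔔 ∈ hℓ.place.primesAbove, ∀ F : absoluteGaloisGroup K, IsArithFrobAt (𝓞 K) F 𝔔 →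
            F ∈ torsionFixing (W.baseChange K) ((p ^ M : ℕ) : ℤ) →
            ∀ σ ∈ 𝔔.inertia (absoluteGaloisGroup K),
            e (h1Eval (W.baseChange K) ((p ^ M : ℕ) : ℤ) s F)
              (h1Eval (W.baseChange K) ((p ^ M : ℕ) : ℤ) c' σ) = 0)
    (hK1 : ∀ [W.IsElliptic] (_hK : IsImaginaryQuadratic K)
      (_hH : SatisfiesHeegnerHypothesis N K) {P : (W.baseChange K).toAffine.Point}
      (_hP : IsHeegnerPoint N W K P) (_hnt : ¬ IsOfFinAddOrder P) (p : ℕ) (_hp : p.Prime),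
      (p = 2 ∨ (NumberField.discr K = -3 ∧ p = 3) ∨ ¬ W.HasSurjectiveModNGaloisRep p) →
      Set.Finite {c : (W.baseChange K).sha | ∃ j : ℕ, p ^ j • c = 0}) :
    kolyvagin N W K := by
  intro _ hK hH P hP hnt
  haveI : (W.baseChange K).IsElliptic := inferInstanceAs (W.map (algebraMap ℚ K)).IsElliptic
  obtain ⟨c, hc, hcc⟩ := exists_conj_of_isImaginaryQuadratic K hK
  obtain ⟨p₁, hp₁⟩ := serre_open_image_holds W hE
  refine (W.baseChange K).mordellWeilRank_eq_one_and_shaFinite_of_hypothesesM hnt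
    (Pl := HeightOneSpectrum (𝓞 K) ⊕ InfinitePlace K)
    (R := fun p ↦ p = 2 ∨ (NumberField.discr K = -3 ∧ p = 3) ∨ ¬ W.HasSurjectiveModNGaloisRep p)
    ⟨max p₁ 4, fun p hp hle ↦ ?_⟩ (fun p hp hRp ↦ ?_) (fun p hp hRp ↦ hK1 hK hH hP hnt p hp hRp)
  · -- no residual prime beyond `max p₁ 4`
    have h4 : 4 ≤ p := (le_max_right _ _).trans hle
    rintro (rfl | ⟨-, rfl⟩ | hnsurj)
    · omega
    · omega
    · exact hnsurj (hp₁ p hp ((le_max_left _ _).trans hle))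
  · -- the data at a non-residual prime `p`
    have hp2 : p ≠ 2 := fun h ↦ hRp (Or.inl h)
    have hp3 : NumberField.discr K = -3 → p ≠ 3 := fun hD h3 ↦ hRp (Or.inr (Or.inl ⟨hD, h3⟩))
    have hρ : W.HasSurjectiveModNGaloisRep p := by
      by_contra hn
      exact hRp (Or.inr (Or.inr hn))
    -- `E(K)[p] = 0`, `M₀`, `x₀`
    have hbot := torsionBy_eq_bot_of_isImaginaryQuadratic W K hK hp hp2 hρ
    have hA : ∀ a : (W.baseChange K).toAffine.Point, p • a = 0 → a = 0 := fun a ha ↦ by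
      have : a ∈ AddSubgroup.torsionBy (W.baseChange K).toAffine.Point (p : ℤ) := by
        rw [mem_torsionBy_iff, natCast_zsmul]; exact ha
      rw [hbot] at this
      exact this
    obtain ⟨M₀, x₀, hx₀, -, hgen⟩ := exists_kummer_generator_pow (W.baseChange K) hp hA hnt
    have hdivj : ∀ j : ℕ, ∀ Q : geomPoints (W.baseChange K), ∃ R, ((p ^ j : ℕ) : ℤ) • R = Q :=
      fun j ↦ (W.baseChange K).zsmul_geomPoints_surjective_holds
        (by exact_mod_cast pow_ne_zero j hp.ne_zero)
    have key : ∀ j : ℕ, 1 ≤ j →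
        ∃ S : HypothesesM (galH1Torsion (W.baseChange K) ((p ^ j : ℕ) : ℤ))
            (HeightOneSpectrum (𝓞 K) ⊕ InfinitePlace K),
          S.Sel = selmerGroup (W.baseChange K) ((p ^ j : ℕ) : ℤ) ∧
          S.x = kummerMapTorsion (W.baseChange K) _ (hdivj j) x₀ ∧ S.p = p ∧ S.M₀ = M₀ ∧
          S.M = j := by
      intro j hj
      obtain ⟨ε, τ, hτ, A, hAd, Pt, hPt, hε, h53, hAτ, hPt1, hm⟩ :=
        hpoints hK hH hP hnt hp hp2 hp3 hρ hj (hdivj j) c hc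
      obtain ⟨cl, hc1, hcl⟩ := exists_leafA_of_points (N := N) (hdivj j) c hτ ε A hAd hAτ Pt hPt
        hPt1 (fun m hm' hk ↦ (hm m hm' hk).1) (fun m hm' hk ↦ (hm m hm' hk).2.1)
        (fun m hm' hk ↦ (hm m hm' hk).2.2)
      obtain ⟨hPx, hxord⟩ := hgen j (by omega) (hdivj j)
      exact exists_hypothesesM_of_leavesM (N := N) hK hp hp2 hρ Automorphic.chebotarev_artinRep_holds
        (exists_weilPairing_holds W p) hj (hdivj j) hc hcc hx₀ hPx hxord ε hε h53 cl hc1 hcl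
        (hdual_of_kolyvaginReciprocityM W hK hP hp hp2 hj hc
          (fun hℓ hfr ↦ hR hK hH hP hnt hp hp2 hj hℓ hfr))
    choose T hT using key
    refine ⟨M₀, x₀, T, hx₀, fun j hj ↦
      ⟨(hT j hj).2.2.1, (hT j hj).2.2.2.1, (hT j hj).2.2.2.2, (hT j hj).1, ?_⟩⟩
    rw [(hT j hj).2.1, AddMonoidHom.mem_ker]
    exact torsionH1ToH1_kummerMapTorsion _ _ _ x₀

/-- **Kolyvagin's Theorem A (`kolyvagin N W K`) for every `E/ℚ` and every `K`, from points and
reciprocity** — the whole of Kolyvagin's theorem in the tree's currency. Inputs: `hR`, Kolyvagin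
reciprocity (R)_M at every Kolyvagin prime of level `M` (odd `p`, `M ≥ 1`); for `E` without CM,
the point-level leaf (A') at `p ∤ 2u_K` with `ρ̄_{E,p}` onto and [K1] at the residual primes
(`hpoints`, `hK1` — `kolyvagin_of_pointsM_of_not_hasCM`); for `E` with CM, off a finite residual
set `p ≠ 2`, `E(K)[p] = 0`, McCallum's Cor. 3.2 at level `p^M` for the CM image and the
point-level leaf (A'), and [K1] on it (`hCM` —
`Kolyvagin1990_thmA_of_hasCM_or_discr_of_pointsM_of_localDataM`, the leaf being Theorem A itself
when `E` has CM). The two leaves `Kolyvagin1990_sha_primary_finite`,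
`Kolyvagin1990_thmA_of_hasCM_or_discr` of `kolyvagin_of_Gross1991` then follow from the same
inputs (`Kolyvagin1990_sha_primary_finite_of_kolyvagin`,
`Kolyvagin1990_thmA_of_hasCM_or_discr_of_kolyvagin`, `HeegnerPointsKolyvaginDescentProofs`).
[cite: McCallumLMS1991, §1 Theorem (Kolyvagin), §§2–5] [cite: GrossLMS1991, §1 Thm. 1.3, §2]
[cite: Serre1972, §4.2 Thm. 2] -/
theorem kolyvagin_of_pointsM
    (hR : ∀ [W.IsElliptic] (_hK : IsImaginaryQuadratic K) (_hH : SatisfiesHeegnerHypothesis N K)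
      {P : (W.baseChange K).toAffine.Point} (_hP : IsHeegnerPoint N W K P)
      (_hnt : ¬ IsOfFinAddOrder P) {p : ℕ} (_hp : p.Prime) (_hp2 : p ≠ 2) {M : ℕ} (_hM : 1 ≤ M)
      {ℓ : ℕ} (hℓ : IsKolyvaginPrime N W K p ℓ), FrobEqFrobInfty W K (p ^ M) ℓ →
      ∃ (A : Type u) (_ : AddCommGroup A)
        (e : geomTorsion (W.baseChange K) ((p ^ M : ℕ) : ℤ) →+
          geomTorsion (W.baseChange K) ((p ^ M : ℕ) : ℤ) →+ A),
        (∀ x, e x x = 0) ∧ (∀ x, (∀ y, e x y = 0) → x = 0) ∧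
        ∀ s ∈ selmerGroup (W.baseChange K) ((p ^ M : ℕ) : ℤ),
          ∀ c' : galH1Torsion (W.baseChange K) ((p ^ M : ℕ) : ℤ),
          (∀ v : HeightOneSpectrum (𝓞 K), (ℓ : 𝓞 K) ∉ v.asIdeal →
            c' ∈ selmerLocalKer (W.baseChange K) (v.adicCompletion K) ((p ^ M : ℕ) : ℤ)) →
          (∀ w : InfinitePlace K,
            c' ∈ selmerLocalKer (W.baseChange K) w.Completion ((p ^ M : ℕ) : ℤ)) →
          ∀ 𝔔 ∈ hℓ.place.primesAbove, ∀ F : absoluteGaloisGroup K, IsArithFrobAt (𝓞 K) F 𝔔 →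
            F ∈ torsionFixing (W.baseChange K) ((p ^ M : ℕ) : ℤ) →
            ∀ σ ∈ 𝔔.inertia (absoluteGaloisGroup K),
            e (h1Eval (W.baseChange K) ((p ^ M : ℕ) : ℤ) s F)
              (h1Eval (W.baseChange K) ((p ^ M : ℕ) : ℤ) c' σ) = 0)
    (hpoints : ∀ [W.IsElliptic] (_hE : ¬ W.HasCM) (_hK : IsImaginaryQuadratic K)
      (_hH : SatisfiesHeegnerHypothesis N K)
      {P : (W.baseChange K).toAffine.Point} (_hP : IsHeegnerPoint N W K P)
      (_hnt : ¬ IsOfFinAddOrder P) {p : ℕ} (_hp : p.Prime) (_hp2 : p ≠ 2)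
      (_hp3 : NumberField.discr K = -3 → p ≠ 3)
      (_hρ : W.HasSurjectiveModNGaloisRep p) {M : ℕ} (_hM : 1 ≤ M)
      (hdiv : ∀ Q : geomPoints (W.baseChange K), ∃ R, ((p ^ M : ℕ) : ℤ) • R = Q)
      (c : K ≃ₐ[ℚ] K) (_hc : c ≠ 1),
      ∃ (ε : ℤ) (τ : AlgebraicClosure K ≃+* AlgebraicClosure K) (hτ : IsLiftOfAut c τ)
        (A : ℕ → AddSubgroup (geomPoints (W.baseChange K)))
        (hA : ∀ m, KolyvaginCocycle.IsAdmissible (Field.absoluteGaloisGroup K) (A m)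
          ((p ^ M : ℕ) : ℤ))
        (Pt : ℕ → geomPoints (W.baseChange K))
        (hPt : ∀ m, Pt m ∈
          KolyvaginCocycle.invPoints (Field.absoluteGaloisGroup K) (A m) ((p ^ M : ℕ) : ℤ)),
        (ε = 1 ∨ ε = -1) ∧
        IsOfFinAddOrder (Affine.Point.map (W' := W) (c : K →ₐ[ℚ] K) P - ε • P) ∧
        (∀ m, ∀ a ∈ A m, hτ.pointsMap W a ∈ A m) ∧
        Pt 1 = toGeomPoints (W.baseChange K) P ∧
        (∀ m : ℕ, Squarefree m →
          (∀ q ∈ m.primeFactors, IsKolyvaginPrime N W K p q ∧ FrobEqFrobInfty W K (p ^ M) q) →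
          (∃ B ∈ A m, hτ.pointsMap W (Pt m) =
            (ε * (-1) ^ m.primeFactors.card) • Pt m + ((p ^ M : ℕ) : ℤ) • B) ∧
          (∀ v : HeightOneSpectrum (𝓞 K), (m : 𝓞 K) ∉ v.asIdeal →
            kolyvaginClass (W.baseChange K) _ hdiv (hA m) (Pt m) (hPt m) ∈
              selmerLocalKer (W.baseChange K) (v.adicCompletion K) ((p ^ M : ℕ) : ℤ)) ∧
          (∀ ℓ : ℕ, ℓ.Prime → ℓ ∣ m → ∀ v : HeightOneSpectrum (𝓞 K), (ℓ : 𝓞 K) ∈ v.asIdeal →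
            ∀ a : ℕ, (((p : ℤ) ^ a) •
                kolyvaginClass (W.baseChange K) _ hdiv (hA m) (Pt m) (hPt m) ∈
                selmerLocalKer (W.baseChange K) (v.adicCompletion K) ((p ^ M : ℕ) : ℤ) ↔
              ((p : ℤ) ^ a) • kolyvaginClass (W.baseChange K) _ hdiv (hA (m / ℓ)) (Pt (m / ℓ))
                  (hPt (m / ℓ)) ∈
                (W.baseChange K).torsionLocalKer (v.adicCompletion K) ((p ^ M : ℕ) : ℤ)))))
    (hK1 : ∀ [W.IsElliptic] (_hE : ¬ W.HasCM) (_hK : IsImaginaryQuadratic K)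
      (_hH : SatisfiesHeegnerHypothesis N K) {P : (W.baseChange K).toAffine.Point}
      (_hP : IsHeegnerPoint N W K P) (_hnt : ¬ IsOfFinAddOrder P) (p : ℕ) (_hp : p.Prime),
      (p = 2 ∨ (NumberField.discr K = -3 ∧ p = 3) ∨ ¬ W.HasSurjectiveModNGaloisRep p) →
      Set.Finite {c : (W.baseChange K).sha | ∃ j : ℕ, p ^ j • c = 0})
    (hCM : ∀ [W.IsElliptic] (_hE : W.HasCM)
      (_hK : IsImaginaryQuadratic K) (_hH : SatisfiesHeegnerHypothesis N K)
      {P : (W.baseChange K).toAffine.Point} (_hP : IsHeegnerPoint N W K P)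
      (_hnt : ¬ IsOfFinAddOrder P),
      ∃ R : ℕ → Prop, (∃ B : ℕ, ∀ p : ℕ, p.Prime → B ≤ p → ¬ R p) ∧
        (∀ (p : ℕ) (_hp : p.Prime) (_hRp : ¬ R p), p ≠ 2 ∧
          AddSubgroup.torsionBy (W.baseChange K).toAffine.Point (p : ℤ) = ⊥ ∧
          ∀ (M : ℕ) (_hM : 1 ≤ M)
            (hdiv : ∀ Q : geomPoints (W.baseChange K), ∃ R', ((p ^ M : ℕ) : ℤ) • R' = Q)
            (c : K ≃ₐ[ℚ] K) (_hc : c ≠ 1),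
            (∀ (r : ℕ) (cs : Fin r → galH1Torsion (W.baseChange K) ((p ^ M : ℕ) : ℤ))
              (Nv : Fin r → ℕ), (∀ i, cs i ≠ 0) →
              (∀ i, Nv i ≠ 0 → ((p : ℤ) ^ (Nv i - 1)) • cs i ≠ 0) →
              (∀ i, ∃ e : ℤ, (e = 1 ∨ e = -1) ∧
                conjAct W c ((p ^ M : ℕ) : ℤ) (cs i) = e • cs i) →
              (∀ a : Fin r → ℤ, ∑ i, a i • cs i = 0 → ∀ i, a i • cs i = 0) →
              ∀ b : ℕ, ∃ ℓ : ℕ, b < ℓ ∧ IsKolyvaginPrime N W K p ℓ ∧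
                FrobEqFrobInfty W K (p ^ M) ℓ ∧
                ∀ i, ∀ v : HeightOneSpectrum (𝓞 K), (ℓ : 𝓞 K) ∈ v.asIdeal →
                  (((p : ℤ) ^ Nv i) • cs i ∈
                      (W.baseChange K).torsionLocalKer (v.adicCompletion K) ((p ^ M : ℕ) : ℤ) ∧
                    (Nv i ≠ 0 → ((p : ℤ) ^ (Nv i - 1)) • cs i ∉
                      (W.baseChange K).torsionLocalKer (v.adicCompletion K)
                        ((p ^ M : ℕ) : ℤ)))) ∧
            ∃ (ε : ℤ) (τ : AlgebraicClosure K ≃+* AlgebraicClosure K) (hτ : IsLiftOfAut c τ)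
              (A : ℕ → AddSubgroup (geomPoints (W.baseChange K)))
              (hA : ∀ m, KolyvaginCocycle.IsAdmissible (Field.absoluteGaloisGroup K) (A m)
                ((p ^ M : ℕ) : ℤ))
              (Pt : ℕ → geomPoints (W.baseChange K))
              (hPt : ∀ m, Pt m ∈
                KolyvaginCocycle.invPoints (Field.absoluteGaloisGroup K) (A m)
                  ((p ^ M : ℕ) : ℤ)),
              (ε = 1 ∨ ε = -1) ∧
              IsOfFinAddOrder (Affine.Point.map (W' := W) (c : K →ₐ[ℚ] K) P - ε • P) ∧
              (∀ m, ∀ a ∈ A m, hτ.pointsMap W a ∈ A m) ∧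
              Pt 1 = toGeomPoints (W.baseChange K) P ∧
              (∀ m : ℕ, Squarefree m →
                (∀ q ∈ m.primeFactors,
                  IsKolyvaginPrime N W K p q ∧ FrobEqFrobInfty W K (p ^ M) q) →
                (∃ B ∈ A m, hτ.pointsMap W (Pt m) =
                  (ε * (-1) ^ m.primeFactors.card) • Pt m + ((p ^ M : ℕ) : ℤ) • B) ∧
                (∀ v : HeightOneSpectrum (𝓞 K), (m : 𝓞 K) ∉ v.asIdeal →
                  kolyvaginClass (W.baseChange K) _ hdiv (hA m) (Pt m) (hPt m) ∈
                    selmerLocalKer (W.baseChange K) (v.adicCompletion K) ((p ^ M : ℕ) : ℤ)) ∧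
                (∀ ℓ : ℕ, ℓ.Prime → ℓ ∣ m → ∀ v : HeightOneSpectrum (𝓞 K),
                  (ℓ : 𝓞 K) ∈ v.asIdeal →
                  ∀ a : ℕ, (((p : ℤ) ^ a) •
                      kolyvaginClass (W.baseChange K) _ hdiv (hA m) (Pt m) (hPt m) ∈
                      selmerLocalKer (W.baseChange K) (v.adicCompletion K) ((p ^ M : ℕ) : ℤ) ↔
                    ((p : ℤ) ^ a) •
                        kolyvaginClass (W.baseChange K) _ hdiv (hA (m / ℓ)) (Pt (m / ℓ))
                          (hPt (m / ℓ)) ∈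
                      (W.baseChange K).torsionLocalKer (v.adicCompletion K)
                        ((p ^ M : ℕ) : ℤ))))) ∧
        (∀ p : ℕ, p.Prime → R p →
          Set.Finite {c : (W.baseChange K).sha | ∃ j : ℕ, p ^ j • c = 0})) :
    kolyvagin N W K := by
  intro _ hK hH P hP hnt
  by_cases hE : W.HasCM
  · -- CM: the leaf is Theorem A itself
    have hleaf : Kolyvagin1990_thmA_of_hasCM_or_discr N W K := by
      refine Kolyvagin1990_thmA_of_hasCM_or_discr_of_pointsM_of_localDataM N W K hR ?_
      intro _ _ hK' hH' P' hP' hnt'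
      exact hCM hE hK' hH' hP' hnt'
    exact hleaf (Or.inl hE) hK hH hP hnt
  · -- no CM: `kolyvagin_of_pointsM_of_not_hasCM`
    have hkol : kolyvagin N W K := by
      refine kolyvagin_of_pointsM_of_not_hasCM N W K hE ?_ hR ?_
      · intro _ hK' hH' P' hP' hnt' p hp hp2 hp3 hρ M hM hdiv c hc
        exact hpoints hE hK' hH' hP' hnt' hp hp2 hp3 hρ hM hdiv c hc
      · intro _ hK' hH' P' hP' hnt' p hp hres
        exact hK1 hE hK' hH' hP' hnt' p hp hres
    exact hkol hK hH hP hnt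

end AllFields

end Literature.NumberTheory.EllipticCurves

end
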